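import Summits.Schanuel.Schanuel.Theorems.ZilberEacSuperellipticConstFibre
import Summits.Schanuel.Schanuel.Theorems.ZilberEacBranchPoleFibreGrowth
import HarnessLib

/-!
# Arbitrary base branches, XXXIII: the COORDINATE fibres `y₀ = x₁` and `y₀ = x₀` over the
# superelliptic curves `x₁^k = P(x₀)` are in Mantova–Masser's case AND dense, off one residue class

HONEST FRAMING.  Cell `pub-schanuel` (Zilber's Exponential-Algebraic Closedness, case ladder;
host summit Schanuel), seat 2, gen 29.  Until file XXXII every decided surface over a NON-rational
base curve had a fibre value tending to a finite nonzero limit along the branch at infinity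
(constant fibres, or graph fibres engineered to cancel the pole).  The simplest surfaces of the
case — a coordinate function as fibre, `y₀ = x₁` or `y₀ = x₀`, over a curve with a cusp at
infinity — have a POLE of the fibre value there.  By file XXXII such cylinders are dense whenever
the branch has a good direction, i.e. for `C : x₁^k = P(x₀)` (`P` monic of degree `M ≥ 1` with a
simple root; branch `x₀ = s^{-k}`, `x₁ = U₀(s)^{1/k}s^{-M}`) whenever `¬(k ∣ 2M ∧ 2M/k ≡ 2 mod 4)`:
**`unprojectedDensityQuestion_superelliptic_fibre_x₁`**, **`…_fibre_x₀`** — `{x₁^k − P(x₀) = 0,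
y₀ = x₁}` and `{x₁^k − P(x₀) = 0, y₀ = x₀}` are in the case AND dense for ALL `k ≥ 2`, `M ≥ 1` off
the residue class, in every regime (`M < k`: e.g. **`{x₁³ = x₀² + 1, y₀ = x₁}`**, the slow cusp of
the cell's notes O84 (v); `M = k`; `M > k`: e.g. every odd-degree hyperelliptic curve
**`unprojectedDensityQuestion_hyperellipticOdd_fibre_x₁`**).  The residue class (e.g. `x₁² = x₀⁶ + 1`
with `y₀ = x₁`) needs the logarithmic term of the pole and stays for the next file.  Decided
instances of an OPEN question (Mantova–Masser, PLMS 2024 §1 p. 5); EC(3,2) OPEN; NOT Schanuel's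
conjecture (neither used nor implied); EAC ⇏ SC.
-/

noncomputable section

open Filter Topology Set Complex MvPolynomial
open Literature.NumberTheory.Transcendental Literature.ModelTheory.Zilber
open Literature.ModelTheory.ExponentialFields

set_option linter.dupNamespace false

namespace Summit.Schanuel.Schanuel.Theorems

section Superelliptic

variable (P : Polynomial ℂ)

/-! ## Part A. The curve `x₁^k = P(x₀)`: points off coordinate values and off lines -/

/-- A point of `x₁^k = P(x₀)` with both coordinates nonzero (`k ≥ 1`, `P ≠ 0`). [folklore] -/
theorem superelliptic_exists_point_ne_zero {k : ℕ} (hk : 1 ≤ k) (hP0 : P ≠ 0) :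
    ∃ x : Fin 2 → ℂ, MvPolynomial.eval x
      (X 1 ^ k - Polynomial.aeval (X 0 : MvPolynomial (Fin 2) ℂ) P) = 0 ∧ x 0 ≠ 0 ∧ x 1 ≠ 0 := by
  classical
  -- `P` has finitely many roots: pick `x₀ ∉ roots ∪ {0}`
  obtain ⟨x₀, hx₀⟩ := (P.roots.toFinset ∪ {0}).exists_notMem
  rw [Finset.mem_union, Finset.mem_singleton, not_or, Multiset.mem_toFinset,
    Polynomial.mem_roots hP0] at hx₀
  obtain ⟨y, hy⟩ := IsAlgClosed.exists_pow_nat_eq (P.eval x₀) (by omega : 0 < k)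
  refine ⟨![x₀, y], by rw [eval_superellipticMv]; simp [hy], hx₀.2, ?_⟩
  intro hy0
  simp only [Matrix.cons_val_one, Matrix.cons_val_zero] at hy0
  rw [hy0, zero_pow (by omega)] at hy
  exact hx₀.1 hy.symm

/-- No line `m₀x₀ + m₁x₁ = c` (`m ≠ 0`) contains the curve `x₁^k = P(x₀)` (`k ≥ 2`, `P ≠ 0`): either
`m₁ = 0` and the points over `x₀ = 0, 1` differ, or the `μ_k`-action `x₁ ↦ ωx₁` forces `P ≡ 0`.
[folklore] -/
theorem superelliptic_not_on_line {k : ℕ} (hk : 2 ≤ k) (hP0 : P ≠ 0) (m : Fin 2 → ℤ) (hm : m ≠ 0)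
    (c₀ : ℂ) : ∃ x : Fin 2 → ℂ, MvPolynomial.eval x
      (X 1 ^ k - Polynomial.aeval (X 0 : MvPolynomial (Fin 2) ℂ) P) = 0 ∧
      (m 0 : ℂ) * x 0 + (m 1 : ℂ) * x 1 ≠ c₀ := by
  have hk0 : k ≠ 0 := by omega
  by_contra hall
  push Not at hall
  have hpt : ∀ x y : ℂ, y ^ k = P.eval x → (m 0 : ℂ) * x + (m 1 : ℂ) * y = c₀ := by
    intro x y hy
    have := hall ![x, y] (by rw [eval_superellipticMv]; simp [hy])
    simpa using this
  by_cases hm1 : (m 1 : ℂ) = 0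
  · have hm0 : (m 0 : ℂ) ≠ 0 := by
      intro h0
      apply hm
      funext i
      fin_cases i
      · exact_mod_cast h0
      · exact_mod_cast hm1
    obtain ⟨y₀, hy₀⟩ := IsAlgClosed.exists_pow_nat_eq (P.eval 0) (by omega : 0 < k)
    obtain ⟨y₁, hy₁⟩ := IsAlgClosed.exists_pow_nat_eq (P.eval 1) (by omega : 0 < k)
    have h0 := hpt 0 y₀ hy₀
    have h1 := hpt 1 y₁ hy₁
    rw [hm1] at h0 h1
    apply hm0
    linear_combination h1 - h0
  · have hω := Complex.isPrimitiveRoot_exp k hk0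
    set ω : ℂ := Complex.exp (2 * Real.pi * I / k) with hωdef
    have hωk : ω ^ k = 1 := hω.pow_eq_one
    have hω1 : ω ≠ 1 := hω.ne_one (by omega)
    have hzero : ∀ x : ℂ, P.eval x = 0 := by
      intro x
      obtain ⟨y, hy⟩ := IsAlgClosed.exists_pow_nat_eq (P.eval x) (by omega : 0 < k)
      have hy1 := hpt x y hy
      have hy2 := hpt x (ω * y) (by rw [mul_pow, hωk, one_mul]; exact hy)
      have hy0 : y = 0 := by
        have h2 : (m 1 : ℂ) * (y * (1 - ω)) = 0 := by linear_combination hy1 - hy2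
        rcases mul_eq_zero.1 h2 with h | h
        · exact absurd h hm1
        · rcases mul_eq_zero.1 h with h' | h'
          · exact h'
          · exact absurd (by linear_combination -h') hω1
      rw [← hy, hy0, zero_pow hk0]
    exact hP0 (Polynomial.funext (by simpa using hzero))

/-! ## Part B. The fibre `y₀ = x₁` -/

/-- **The cylinder `y₀ = x₁` over `x₁^k = P(x₀)` is dense off the residue class** (`k ≥ 1`, `P`
monic of degree `M ≥ 1` with a simple root, `¬(k ∣ 2M ∧ 2M/k ≡ 2 mod 4)`): along the branch at
infinity the fibre value `y₀ = x₁ = U₀(s)^{1/k}s^{-M}` has a POLE (file XXXII).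
[cite: MantovaMasser2023, §1 Further remarks, p. 5 (the question, open in general)] (new) -/
theorem unprojectedDense_superelliptic_fibre_x₁ {k : ℕ} (hk : 1 ≤ k) (hP : P.Monic)
    (hM : 1 ≤ P.natDegree) {r : ℂ} (hr : P.IsRoot r) (hr1 : P.derivative.eval r ≠ 0)
    (hres : ¬ (k ∣ 2 * P.natDegree ∧ (2 * P.natDegree / k) % 4 = 2)) :
    UnprojectedDense {w : Fin 2 ⊕ Fin 2 → ℂ |
      MvPolynomial.eval ![w (Sum.inl 0), w (Sum.inl 1)]
          (X 1 ^ k - Polynomial.aeval (X 0 : MvPolynomial (Fin 2) ℂ) P) = 0 ∧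
      w (Sum.inr 0) = MvPolynomial.eval ![w (Sum.inl 0), w (Sum.inl 1)]
        (X 1 : MvPolynomial (Fin 2) ℂ)} := by
  set M := P.natDegree with hMdef
  have hS := isIrreducibleClosed_curveGraphFibre (X 1 : MvPolynomial (Fin 2) ℂ)
    (irreducible_superellipticMv P hk hr hr1)
  have hdim := zariskiDim_curveGraphFibre (X 1 : MvPolynomial (Fin 2) ℂ)
    (irreducible_superellipticMv P hk hr hr1)
  obtain ⟨q, hqan, hq0, hqk⟩ := kthRoot_branch_facts hk
  obtain ⟨U₀, hUan, hU0, hUeval⟩ :=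
    exists_polarForm_eval P (U := fun _ : ℂ => (1 : ℂ)) analyticAt_const hk
  rw [one_pow, mul_one, hP.leadingCoeff] at hU0
  have hvan : AnalyticAt ℂ (fun s => U₀ s - 1) 0 := hUan.sub analyticAt_const
  have hv0 : U₀ 0 - 1 = 0 := by rw [hU0, sub_self]
  set Φ : ℂ → ℂ := fun s => q (U₀ s - 1) with hΦ
  have hΦan : AnalyticAt ℂ Φ 0 := hqan.comp_of_eq hvan hv0
  have hΦ0 : Φ 0 = 1 := by
    simp only [hΦ, hU0, sub_self]
    exact hq0
  have hqk' : ∀ᶠ s in 𝓝 (0 : ℂ), q (U₀ s - 1) ^ k = 1 + (U₀ s - 1) := by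
    have h := hvan.continuousAt.tendsto
    rw [hv0] at h
    exact h.eventually hqk
  -- the germ: `x₀ = s^{-k}`, `x₁ = Φ(s)s^{-M}`, `y₀ = x₁ = Φ(s)·s^{-M}` (a pole of order `M`)
  have hgerm : ∀ᶠ s in 𝓝[≠] (0 : ℂ),
      (Sum.elim ![(s ^ k)⁻¹, Φ s * (s ^ M)⁻¹]
          ![Φ s * s ^ (-(M : ℤ)), Complex.exp (Φ s * (s ^ M)⁻¹)] : Fin 2 ⊕ Fin 2 → ℂ) ∈
        {w : Fin 2 ⊕ Fin 2 → ℂ |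
          MvPolynomial.eval ![w (Sum.inl 0), w (Sum.inl 1)]
              (X 1 ^ k - Polynomial.aeval (X 0 : MvPolynomial (Fin 2) ℂ) P) = 0 ∧
          w (Sum.inr 0) = MvPolynomial.eval ![w (Sum.inl 0), w (Sum.inl 1)]
            (X 1 : MvPolynomial (Fin 2) ℂ)} := by
    filter_upwards [self_mem_nhdsWithin, nhdsWithin_le_nhds hqk'] with s (hs : s ≠ 0) hqs
    refine ⟨?_, ?_⟩
    · simp only [Sum.elim_inl, Matrix.cons_val_zero, Matrix.cons_val_one]
      rw [eval_superellipticMv]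
      simp only [Matrix.cons_val_zero, Matrix.cons_val_one, hΦ]
      have hU := hUeval s hs
      simp only [one_mul, inv_pow] at hU
      rw [mul_pow, hqs, hU, inv_pow, ← pow_mul, Nat.mul_comm M k,
        show (1 : ℂ) + (U₀ s - 1) = U₀ s by ring, sub_self]
    · simp only [Sum.elim_inr, Sum.elim_inl, Matrix.cons_val_zero, Matrix.cons_val_one,
        MvPolynomial.eval_X, zpow_neg, zpow_natCast]
  exact unprojectedDense_branch_poleFibre_of_not_residue hS (le_of_eq hdim) hk hM hres (-(M : ℤ))
    hΦan (by rw [hΦ0]; exact one_ne_zero) hΦan hΦ0 hgerm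

/-- **The cylinder `y₀ = x₁` over `x₁^k = P(x₀)` is in Mantova–Masser's case** (`k ≥ 2`, `P` with
a simple root). (new) -/
theorem mmCase_superelliptic_fibre_x₁ {k : ℕ} (hk : 2 ≤ k) {r : ℂ} (hr : P.IsRoot r)
    (hr1 : P.derivative.eval r ≠ 0) :
    MMCaseDimPiOneFree {w : Fin 2 ⊕ Fin 2 → ℂ |
      MvPolynomial.eval ![w (Sum.inl 0), w (Sum.inl 1)]
          (X 1 ^ k - Polynomial.aeval (X 0 : MvPolynomial (Fin 2) ℂ) P) = 0 ∧
      w (Sum.inr 0) = MvPolynomial.eval ![w (Sum.inl 0), w (Sum.inl 1)]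
        (X 1 : MvPolynomial (Fin 2) ℂ)} := by
  have hP0 : P ≠ 0 := by
    rintro rfl
    simp at hr1
  refine mmCase_curveGraphFibre (irreducible_superellipticMv P (by omega) hr hr1) ?_
    (superelliptic_not_on_line P hk hP0)
  obtain ⟨x, hx, -, hx1⟩ := superelliptic_exists_point_ne_zero P (k := k) (by omega) hP0
  exact ⟨x, hx, by rw [MvPolynomial.eval_X]; exact hx1⟩

/-- **Mantova–Masser's question for `{x₁^k − P(x₀) = 0, y₀ = x₁}`: case ∧ dense** (`k ≥ 2`, `P`
monic of degree `M ≥ 1` with a simple root, `¬(k ∣ 2M ∧ 2M/k ≡ 2 mod 4)`), in plain coordinates.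
[cite: MantovaMasser2023, §1 Further remarks, p. 5 (the question, open in general)] (new) -/
theorem unprojectedDensityQuestion_superelliptic_fibre_x₁ {k : ℕ} (hk : 2 ≤ k) (hP : P.Monic)
    (hM : 1 ≤ P.natDegree) {r : ℂ} (hr : P.IsRoot r) (hr1 : P.derivative.eval r ≠ 0)
    (hres : ¬ (k ∣ 2 * P.natDegree ∧ (2 * P.natDegree / k) % 4 = 2)) :
    MMCaseDimPiOneFree {w : Fin 2 ⊕ Fin 2 → ℂ |
        w (Sum.inl 1) ^ k - P.eval (w (Sum.inl 0)) = 0 ∧ w (Sum.inr 0) = w (Sum.inl 1)} ∧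
      UnprojectedDense {w : Fin 2 ⊕ Fin 2 → ℂ |
        w (Sum.inl 1) ^ k - P.eval (w (Sum.inl 0)) = 0 ∧ w (Sum.inr 0) = w (Sum.inl 1)} := by
  have e : {w : Fin 2 ⊕ Fin 2 → ℂ |
        MvPolynomial.eval ![w (Sum.inl 0), w (Sum.inl 1)]
            (X 1 ^ k - Polynomial.aeval (X 0 : MvPolynomial (Fin 2) ℂ) P) = 0 ∧
        w (Sum.inr 0) = MvPolynomial.eval ![w (Sum.inl 0), w (Sum.inl 1)]
          (X 1 : MvPolynomial (Fin 2) ℂ)} =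
      {w : Fin 2 ⊕ Fin 2 → ℂ |
        w (Sum.inl 1) ^ k - P.eval (w (Sum.inl 0)) = 0 ∧ w (Sum.inr 0) = w (Sum.inl 1)} := by
    ext w
    simp only [Set.mem_setOf_eq, eval_superellipticMv, MvPolynomial.eval_X, Matrix.cons_val_zero,
      Matrix.cons_val_one]
  have h : MMCaseDimPiOneFree _ ∧ UnprojectedDense _ :=
    ⟨mmCase_superelliptic_fibre_x₁ P hk hr hr1,
      unprojectedDense_superelliptic_fibre_x₁ P (by omega) hP hM hr hr1 hres⟩
  rw [e] at h
  exact h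

/-! ## Part C. The fibre `y₀ = x₀` -/

/-- **The cylinder `y₀ = x₀` over `x₁^k = P(x₀)` is dense off the residue class**: the fibre
value `y₀ = x₀ = s^{-k}` has a pole of order `k` along the branch (file XXXII with `ψ = 1`).
[cite: MantovaMasser2023, §1 Further remarks, p. 5 (the question, open in general)] (new) -/
theorem unprojectedDense_superelliptic_fibre_x₀ {k : ℕ} (hk : 1 ≤ k) (hP : P.Monic)
    (hM : 1 ≤ P.natDegree) {r : ℂ} (hr : P.IsRoot r) (hr1 : P.derivative.eval r ≠ 0)
    (hres : ¬ (k ∣ 2 * P.natDegree ∧ (2 * P.natDegree / k) % 4 = 2)) :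
    UnprojectedDense {w : Fin 2 ⊕ Fin 2 → ℂ |
      MvPolynomial.eval ![w (Sum.inl 0), w (Sum.inl 1)]
          (X 1 ^ k - Polynomial.aeval (X 0 : MvPolynomial (Fin 2) ℂ) P) = 0 ∧
      w (Sum.inr 0) = MvPolynomial.eval ![w (Sum.inl 0), w (Sum.inl 1)]
        (X 0 : MvPolynomial (Fin 2) ℂ)} := by
  set M := P.natDegree with hMdef
  have hS := isIrreducibleClosed_curveGraphFibre (X 0 : MvPolynomial (Fin 2) ℂ)
    (irreducible_superellipticMv P hk hr hr1)
  have hdim := zariskiDim_curveGraphFibre (X 0 : MvPolynomial (Fin 2) ℂ)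
    (irreducible_superellipticMv P hk hr hr1)
  obtain ⟨q, hqan, hq0, hqk⟩ := kthRoot_branch_facts hk
  obtain ⟨U₀, hUan, hU0, hUeval⟩ :=
    exists_polarForm_eval P (U := fun _ : ℂ => (1 : ℂ)) analyticAt_const hk
  rw [one_pow, mul_one, hP.leadingCoeff] at hU0
  have hvan : AnalyticAt ℂ (fun s => U₀ s - 1) 0 := hUan.sub analyticAt_const
  have hv0 : U₀ 0 - 1 = 0 := by rw [hU0, sub_self]
  set Φ : ℂ → ℂ := fun s => q (U₀ s - 1) with hΦ
  have hΦan : AnalyticAt ℂ Φ 0 := hqan.comp_of_eq hvan hv0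
  have hΦ0 : Φ 0 = 1 := by
    simp only [hΦ, hU0, sub_self]
    exact hq0
  have hqk' : ∀ᶠ s in 𝓝 (0 : ℂ), q (U₀ s - 1) ^ k = 1 + (U₀ s - 1) := by
    have h := hvan.continuousAt.tendsto
    rw [hv0] at h
    exact h.eventually hqk
  have hgerm : ∀ᶠ s in 𝓝[≠] (0 : ℂ),
      (Sum.elim ![(s ^ k)⁻¹, Φ s * (s ^ M)⁻¹]
          ![(fun _ : ℂ => (1 : ℂ)) s * s ^ (-(k : ℤ)), Complex.exp (Φ s * (s ^ M)⁻¹)] :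
            Fin 2 ⊕ Fin 2 → ℂ) ∈
        {w : Fin 2 ⊕ Fin 2 → ℂ |
          MvPolynomial.eval ![w (Sum.inl 0), w (Sum.inl 1)]
              (X 1 ^ k - Polynomial.aeval (X 0 : MvPolynomial (Fin 2) ℂ) P) = 0 ∧
          w (Sum.inr 0) = MvPolynomial.eval ![w (Sum.inl 0), w (Sum.inl 1)]
            (X 0 : MvPolynomial (Fin 2) ℂ)} := by
    filter_upwards [self_mem_nhdsWithin, nhdsWithin_le_nhds hqk'] with s (hs : s ≠ 0) hqs
    refine ⟨?_, ?_⟩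
    · simp only [Sum.elim_inl, Matrix.cons_val_zero, Matrix.cons_val_one]
      rw [eval_superellipticMv]
      simp only [Matrix.cons_val_zero, Matrix.cons_val_one, hΦ]
      have hU := hUeval s hs
      simp only [one_mul, inv_pow] at hU
      rw [mul_pow, hqs, hU, inv_pow, ← pow_mul, Nat.mul_comm M k,
        show (1 : ℂ) + (U₀ s - 1) = U₀ s by ring, sub_self]
    · simp only [Sum.elim_inr, Sum.elim_inl, Matrix.cons_val_zero, MvPolynomial.eval_X, zpow_neg,
        zpow_natCast, one_mul]
  exact unprojectedDense_branch_poleFibre_of_not_residue hS (le_of_eq hdim) hk hM hres (-(k : ℤ))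
    analyticAt_const one_ne_zero hΦan hΦ0 hgerm

/-- **Mantova–Masser's question for `{x₁^k − P(x₀) = 0, y₀ = x₀}`: case ∧ dense** (hypotheses as
for `y₀ = x₁`), in plain coordinates. [cite: MantovaMasser2023, §1 Further remarks, p. 5 (the
question, open in general)] (new) -/
theorem unprojectedDensityQuestion_superelliptic_fibre_x₀ {k : ℕ} (hk : 2 ≤ k) (hP : P.Monic)
    (hM : 1 ≤ P.natDegree) {r : ℂ} (hr : P.IsRoot r) (hr1 : P.derivative.eval r ≠ 0)
    (hres : ¬ (k ∣ 2 * P.natDegree ∧ (2 * P.natDegree / k) % 4 = 2)) :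
    MMCaseDimPiOneFree {w : Fin 2 ⊕ Fin 2 → ℂ |
        w (Sum.inl 1) ^ k - P.eval (w (Sum.inl 0)) = 0 ∧ w (Sum.inr 0) = w (Sum.inl 0)} ∧
      UnprojectedDense {w : Fin 2 ⊕ Fin 2 → ℂ |
        w (Sum.inl 1) ^ k - P.eval (w (Sum.inl 0)) = 0 ∧ w (Sum.inr 0) = w (Sum.inl 0)} := by
  have hP0 : P ≠ 0 := by
    rintro rfl
    simp at hr1
  have hcase : MMCaseDimPiOneFree {w : Fin 2 ⊕ Fin 2 → ℂ |
      MvPolynomial.eval ![w (Sum.inl 0), w (Sum.inl 1)]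
          (X 1 ^ k - Polynomial.aeval (X 0 : MvPolynomial (Fin 2) ℂ) P) = 0 ∧
      w (Sum.inr 0) = MvPolynomial.eval ![w (Sum.inl 0), w (Sum.inl 1)]
        (X 0 : MvPolynomial (Fin 2) ℂ)} := by
    refine mmCase_curveGraphFibre (irreducible_superellipticMv P (by omega) hr hr1) ?_
      (superelliptic_not_on_line P hk hP0)
    obtain ⟨x, hx, hx0, -⟩ := superelliptic_exists_point_ne_zero P (k := k) (by omega) hP0
    exact ⟨x, hx, by rw [MvPolynomial.eval_X]; exact hx0⟩
  have e : {w : Fin 2 ⊕ Fin 2 → ℂ |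
        MvPolynomial.eval ![w (Sum.inl 0), w (Sum.inl 1)]
            (X 1 ^ k - Polynomial.aeval (X 0 : MvPolynomial (Fin 2) ℂ) P) = 0 ∧
        w (Sum.inr 0) = MvPolynomial.eval ![w (Sum.inl 0), w (Sum.inl 1)]
          (X 0 : MvPolynomial (Fin 2) ℂ)} =
      {w : Fin 2 ⊕ Fin 2 → ℂ |
        w (Sum.inl 1) ^ k - P.eval (w (Sum.inl 0)) = 0 ∧ w (Sum.inr 0) = w (Sum.inl 0)} := by
    ext w
    simp only [Set.mem_setOf_eq, eval_superellipticMv, MvPolynomial.eval_X, Matrix.cons_val_zero,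
      Matrix.cons_val_one]
  have h : MMCaseDimPiOneFree _ ∧ UnprojectedDense _ :=
    ⟨hcase, unprojectedDense_superelliptic_fibre_x₀ P (by omega) hP hM hr hr1 hres⟩
  rw [e] at h
  exact h

/-! ## Part D. Examples in every regime -/

/-- **Odd-degree hyperelliptic curves with the fibre `y₀ = x₁`**: for `P` monic of ODD degree with
a simple root, `{x₁² − P(x₀) = 0, y₀ = x₁}` is in the case AND dense (`2M/2 = M` odd).
[cite: MantovaMasser2023, §1 Further remarks, p. 5 (the question, open in general)] (new) -/
theorem unprojectedDensityQuestion_hyperellipticOdd_fibre_x₁ (hP : P.Monic) (hodd : Odd P.natDegree)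
    {r : ℂ} (hr : P.IsRoot r) (hr1 : P.derivative.eval r ≠ 0) :
    MMCaseDimPiOneFree {w : Fin 2 ⊕ Fin 2 → ℂ |
        w (Sum.inl 1) ^ 2 - P.eval (w (Sum.inl 0)) = 0 ∧ w (Sum.inr 0) = w (Sum.inl 1)} ∧
      UnprojectedDense {w : Fin 2 ⊕ Fin 2 → ℂ |
        w (Sum.inl 1) ^ 2 - P.eval (w (Sum.inl 0)) = 0 ∧ w (Sum.inr 0) = w (Sum.inl 1)} := by
  obtain ⟨j, hj⟩ := hodd
  refine unprojectedDensityQuestion_superelliptic_fibre_x₁ P (le_refl 2) hP (by omega) hr hr1 ?_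
  rintro ⟨-, h4⟩
  rw [hj, Nat.mul_div_cancel_left _ (by norm_num : 0 < 2)] at h4
  omega

end Superelliptic

/-- **The slow cusp `{x₁³ = x₀² + 1, y₀ = x₁}`** (`(k, M) = (3, 2)`: the second coordinate grows
SLOWER than the first and the fibre value has a pole — the example named OPEN in the cell's notes
O84 (v)) is in Mantova–Masser's case AND dense. [cite: MantovaMasser2023, §1 Further remarks,
p. 5 (the question, open in general)] (new) -/
theorem unprojectedDensityQuestion_slowCusp_fibre_x₁ :
    MMCaseDimPiOneFree {w : Fin 2 ⊕ Fin 2 → ℂ |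
        w (Sum.inl 1) ^ 3 - (Polynomial.X ^ 2 + 1 : Polynomial ℂ).eval (w (Sum.inl 0)) = 0 ∧
          w (Sum.inr 0) = w (Sum.inl 1)} ∧
      UnprojectedDense {w : Fin 2 ⊕ Fin 2 → ℂ |
        w (Sum.inl 1) ^ 3 - (Polynomial.X ^ 2 + 1 : Polynomial ℂ).eval (w (Sum.inl 0)) = 0 ∧
          w (Sum.inr 0) = w (Sum.inl 1)} := by
  have hmonic : (Polynomial.X ^ 2 + 1 : Polynomial ℂ).Monic := by
    simpa using Polynomial.monic_X_pow_add_C (1 : ℂ) (by norm_num : (2 : ℕ) ≠ 0)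
  have hdeg : (Polynomial.X ^ 2 + 1 : Polynomial ℂ).natDegree = 2 := by
    simpa using Polynomial.natDegree_X_pow_add_C (n := 2) (r := (1 : ℂ))
  have hroot : (Polynomial.X ^ 2 + 1 : Polynomial ℂ).IsRoot I := by
    simp [Polynomial.IsRoot, Complex.I_sq]
  have hder : (Polynomial.derivative (Polynomial.X ^ 2 + 1 : Polynomial ℂ)).eval I ≠ 0 := by
    rw [Polynomial.derivative_add, Polynomial.derivative_one, Polynomial.derivative_X_pow, add_zero,
      Polynomial.eval_mul, Polynomial.eval_C, Polynomial.eval_pow, Polynomial.eval_X]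
    simp [Complex.I_ne_zero]
  refine unprojectedDensityQuestion_superelliptic_fibre_x₁ _ (by norm_num) hmonic (by omega) hroot
    hder ?_
  rw [hdeg]
  decide

end Summit.Schanuel.Schanuel.Theorems

end
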